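import Mathlib
import Literature.Topology.FourManifolds.KhComplex

/-! # Runbook sanity module (pub-sp4mp REVIEW-RUNBOOK): the Frobenius system tables agree with `R[X]/(X² - hX - t)`

AGREEMENT lemmas for the definition cards `GaussDiagram.mergeCoeff` / `GaussDiagram.splitCoeff`
(`Literature.Topology.FourManifolds.KhComplex`), the structure constants of Khovanov's Frobenius algebra
`A = R[X]/(X² - hX - t)` on the basis `1 ↔ false`, `X ↔ true`:

* `mergeCoeff` IS the multiplication of Mathlib's `AdjoinRoot (X ^ 2 - C h * X - C t)` written in the power basis
  (`basisVec_mul_basisVec`);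
* `splitCoeff` IS the comultiplication DUAL to that multiplication under the Frobenius form `ε(1) = 0, ε(X) = 1`
  (Khovanov 2006 §2): `⟨Δ a, b ⊗ c⟩ = ε(a·b·c)` coefficientwise (`splitCoeff_dual_mergeCoeff`), and it is
  counital: `(ε ⊗ id) ∘ Δ = id` (`splitCoeff_counit`).

Ops-runbook seat, 2026-08-21. No new notions; `frobForm`/`basisVec` are the two-line test fixtures. -/

namespace Summit.SmoothPoincare4.Runbook

open Polynomial Literature.Topology.FourManifolds

noncomputable section

variable {R : Type} [CommRing R] (h t : R)

/-- Khovanov's polynomial `X² - hX - t`. -/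
def khPoly : R[X] := X ^ 2 - C h * X - C t

/-- The power basis of `A = R[X]/(X² - hX - t)` indexed by `Bool`: `false ↦ 1`, `true ↦ X`. -/
def basisVec : Bool → AdjoinRoot (khPoly h t)
  | false => 1
  | true => AdjoinRoot.root (khPoly h t)

/-- The relation `X·X = h·X + t·1` in `AdjoinRoot (X² - hX - t)`. -/
theorem root_mul_root :
    AdjoinRoot.root (khPoly h t) * AdjoinRoot.root (khPoly h t) =
      h • AdjoinRoot.root (khPoly h t) + t • (1 : AdjoinRoot (khPoly h t)) := by
  have e : AdjoinRoot.mk (khPoly h t) (X ^ 2 - C h * X - C t) = 0 := AdjoinRoot.mk_self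
  rw [map_sub, map_sub, map_mul, map_pow, AdjoinRoot.mk_X, AdjoinRoot.mk_C, AdjoinRoot.mk_C] at e
  rw [Algebra.smul_def, Algebra.smul_def, AdjoinRoot.algebraMap_eq, mul_one]
  linear_combination e

/-- AGREEMENT (a): `mergeCoeff R h t a b c` is the coefficient of the basis vector `c` in the product `a · b`
computed in Mathlib's `AdjoinRoot (X² - hX - t)`: `eₐ · e_b = ∑_c mergeCoeff a b c • e_c`. -/
theorem basisVec_mul_basisVec (a b : Bool) :
    basisVec h t a * basisVec h t b = ∑ c : Bool, GaussDiagram.mergeCoeff R h t a b c • basisVec h t c := by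
  rw [Fintype.sum_bool]
  cases a <;> cases b <;>
    simp [basisVec, GaussDiagram.mergeCoeff, root_mul_root]

/-- The Frobenius form (counit) `ε : A → R` on the basis: `ε(1) = 0`, `ε(X) = 1` (Khovanov 2006, §2). -/
def frobForm : Bool → R
  | false => 0
  | true => 1

/-- `ε(e_a · e_b)` from the multiplication table: `ε(1·1) = 0`, `ε(1·X) = ε(X·1) = 1`, `ε(X·X) = ε(hX + t) = h`. -/
def pairing (a b : Bool) : R := ∑ c : Bool, GaussDiagram.mergeCoeff R h t a b c * frobForm c

/-- AGREEMENT (a): `splitCoeff` is the comultiplication DUAL to `mergeCoeff` under the Frobenius pairing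
`⟨x, y⟩ = ε(x·y)`: for all basis vectors, `⟨Δ e_a, e_b ⊗ e_c⟩ = ε(e_a · (e_b · e_c))`, i.e.
`∑_{b',c'} splitCoeff a b' c' ⟨e_b', e_b⟩ ⟨e_c', e_c⟩ = ∑_d mergeCoeff b c d · ⟨e_a, e_d⟩`. -/
theorem splitCoeff_dual_mergeCoeff (a b c : Bool) :
    (∑ b' : Bool, ∑ c' : Bool, GaussDiagram.splitCoeff R h t a b' c' * pairing h t b' b * pairing h t c' c) =
      ∑ d : Bool, GaussDiagram.mergeCoeff R h t b c d * pairing h t a d := by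
  simp only [Fintype.sum_bool, pairing]
  cases a <;> cases b <;> cases c <;> simp [GaussDiagram.splitCoeff, GaussDiagram.mergeCoeff, frobForm]

/-- Counitality `(ε ⊗ id) ∘ Δ = id`: `∑_{b'} ε(e_b') splitCoeff a b' c = [a = c]`. -/
theorem splitCoeff_counit (a c : Bool) :
    (∑ b' : Bool, frobForm (R := R) b' * GaussDiagram.splitCoeff R h t a b' c) = if a = c then 1 else 0 := by
  rw [Fintype.sum_bool]
  cases a <;> cases c <;> simp [GaussDiagram.splitCoeff, frobForm]

/-- The pairing is non-degenerate (determinant `-1`): `A` is a FROBENIUS algebra for every `h, t`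
(so `Δ` is determined by `m` and `ε`, which is what `splitCoeff_dual_mergeCoeff` pins down). -/
theorem pairing_det : pairing h t false false * pairing h t true true - pairing h t false true * pairing h t true false = -1 := by
  simp [pairing, GaussDiagram.mergeCoeff, frobForm]

end

end Summit.SmoothPoincare4.Runbook
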